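import Summits.HodgeConjecture.HodgeConjecture.Theorems.F0P3cStCharTSCayleyChartUnitary   -- ★ (C4u) p851894: `exists_cayley_chart_haar`
import Literature.NumberTheory.Automorphic.UnitaryGroupAutomorphicRep                       -- ★ `unitaryGroupOfForm`, `mem_unitaryGroupOfForm_iff`
import HarnessLib

/-!
# F0 · P3c · line LH6 «StCharTS» — WIF antecedent, ELLIPTIC half: brick (C4m) «CAYLEY CHARTS OF `U(J)(K)` AND OF ITS CARTAN `Z(γ₀)` CARRY HAAR» —
# ★ (C4u) read on the MODEL types `↥(unitaryGroupOfForm σ J)` and `↥(Subgroup.centralizer {γ₀})` (subtypes), ROAD v1 §2 step (1)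

Cell `pub/hodgecm-mathlib`, crux H413 = `stmt-HodgeConjecture-24833` (lane `--supports … --as helper`); seat LH5-p02 (g6).  THEOREMS ONLY; Mathlib + ★ (C4u) +
★ `UnitaryGroupAutomorphicRep`.

WHAT.  ★ (C4u) `exists_cayley_chart_haar` is stated for abstract `ρ : G →* GL m K`, `ι : V →+ M_m(K)` given by their ranges.  Here the two instances the assembly
C8b uses are spelled out: (U) `G = ↥(unitaryGroupOfForm σ J)`, `ρ = subtype`, `x = 1`; (T) `G = ↥T` for a subgroup `T` of `↥(unitaryGroupOfForm σ J)` that IS the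
centraliser of `γ₀` (`hT : g ∈ T ↔ g·γ₀ = γ₀·g`; for the road `T = Subgroup.centralizer {γ₀}`), `ρ = subtype ∘ subtype`, `x = γ₀`.  On the Lie side the additive
subgroups `𝔲`, `𝔱 ⊆ M_m(K)` are given by their membership hypotheses (`X ∈ 𝔲 ↔ ᵗ(σX)J + JX = 0`; `X ∈ 𝔱 ↔ … ∧ Xγ₀ = γ₀X`), `ι = subtype`: closed embeddings
because the defining equations are continuous (`continuous_matrix_map_transpose_mul_add`).
* `range_subtype_unitary_iff`, `range_subtype_centralizer_iff`, `isClosed_setOf_skew`, `isClosed_setOf_skew_comm`, `isClosedEmbedding_subtype_of_eq` — the range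
  and embedding facts;
* **`exists_cayley_chart_haar_unitary`** and **`exists_cayley_chart_haar_cartan`** — ★ (C4u) on the two model pairs: levels `Λ`, chart `c`, product `σV`, window, and
  `(μ.restrict (Λ 0)).map c = (μ (Λ 0) ∕ ν (c '' Λ 0)) • ν.restrict (c '' Λ 0)` (+ the image form).

HONEST LABEL: HC_CM is proved only modulo the 7 printed citations (2 remaining named inputs: hLiu418 = `stmt-HodgeConjecture-24832`, h413 =
`stmt-HodgeConjecture-24833`) until rung 0 closes; this file closes no organ.

## References
* [PlatonovRapinchuk1994] V. Platonov, A. Rapinchuk, *Algebraic Groups and Number Theory* (1994), §3.3. Context locator.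
* [Helgason2000] S. Helgason, *Groups and Geometric Analysis* (2000), Ch. I §1 Thm. 1.14 (13) p. 96. Context locator.
-/

set_option autoImplicit false
set_option linter.dupNamespace false

open Set Filter MeasureTheory MeasureTheory.Measure TopologicalSpace Topology Matrix ValuativeRel
open Literature.NumberTheory.Automorphic Literature.NumberTheory.Weil1982.UnitaryFinTopForm
open Summit.HodgeConjecture.HodgeConjecture.Cruxes.H413.F0P3cStCharTSCayleyChartUnitary
open scoped Pointwise Topology ENNReal MatrixGroups

namespace Summit.HodgeConjecture.HodgeConjecture.Cruxes.H413.F0P3cStCharTSCayleyChartUnitaryModel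

/-! ## §1 Ranges and closed embeddings of the model data -/

section Ranges

variable {K : Type*} [Field K] {m : Type*} [Fintype m] [DecidableEq m] (σ : K →+* K) (J : Matrix m m K)

/-- The range of `↥U(J) ↪ GL_m(K)` is `U(J)`, i.e. the unitary matrices commuting with `x = 1`. [cite: PlatonovRapinchuk1994, §3.3] -/
theorem range_subtype_unitary_iff (g : GL m K) :
    g ∈ Set.range ((unitaryGroupOfForm σ J).subtype : ↥(unitaryGroupOfForm σ J) →* GL m K) ↔
      (((g : Matrix m m K).map σ)ᵀ * J * (g : Matrix m m K) = J ∧ (g : Matrix m m K) * 1 = 1 * (g : Matrix m m K)) := by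
  rw [Matrix.mul_one, Matrix.one_mul]
  constructor
  · rintro ⟨u, rfl⟩
    exact ⟨mem_unitaryGroupOfForm_iff.1 u.2, rfl⟩
  · rintro ⟨hg, -⟩
    exact ⟨⟨g, mem_unitaryGroupOfForm_iff.2 hg⟩, rfl⟩

/-- The range of `↥T ↪ ↥U(J) ↪ GL_m(K)` for `T` the centraliser of `γ₀` in `U(J)` is the set of unitary matrices commuting with `γ₀`. [cite: PlatonovRapinchuk1994, §3.3] -/
theorem range_subtype_centralizer_iff {T : Subgroup ↥(unitaryGroupOfForm σ J)} {γ₀ : ↥(unitaryGroupOfForm σ J)}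
    (hT : ∀ g : ↥(unitaryGroupOfForm σ J), g ∈ T ↔ g * γ₀ = γ₀ * g) (g : GL m K) :
    g ∈ Set.range (((unitaryGroupOfForm σ J).subtype).comp T.subtype : ↥T →* GL m K) ↔
      (((g : Matrix m m K).map σ)ᵀ * J * (g : Matrix m m K) = J ∧
        (g : Matrix m m K) * ((γ₀ : GL m K) : Matrix m m K) = ((γ₀ : GL m K) : Matrix m m K) * (g : Matrix m m K)) := by
  constructor
  · rintro ⟨t, rfl⟩
    refine ⟨mem_unitaryGroupOfForm_iff.1 (t : ↥(unitaryGroupOfForm σ J)).2, ?_⟩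
    have h := (hT t).1 t.2
    have h' := congrArg (fun u : ↥(unitaryGroupOfForm σ J) => ((u : GL m K) : Matrix m m K)) h
    simpa using h'
  · rintro ⟨hg, hcomm⟩
    refine ⟨⟨⟨g, mem_unitaryGroupOfForm_iff.2 hg⟩, (hT _).2 ?_⟩, rfl⟩
    apply Subtype.ext
    apply Units.ext
    simpa using hcomm

variable [TopologicalSpace K] [IsTopologicalRing K]

omit [DecidableEq m] in
/-- `X ↦ ᵗ(σ X)·J + J·X` is continuous when `σ` is (entrywise polynomial maps). [cite: PlatonovRapinchuk1994, §3.3] -/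
theorem continuous_matrix_map_transpose_mul_add (hσ : Continuous σ) :
    Continuous fun X : Matrix m m K => (X.map σ)ᵀ * J + J * X :=
  ((continuous_id.matrix_map hσ).matrix_transpose.matrix_mul continuous_const).add (continuous_const.matrix_mul continuous_id)

omit [DecidableEq m] in
/-- The skew matrices form a closed set. [cite: PlatonovRapinchuk1994, §3.3] -/
theorem isClosed_setOf_skew [T2Space K] (hσ : Continuous σ) : IsClosed {X : Matrix m m K | (X.map σ)ᵀ * J + J * X = 0} :=
  isClosed_eq (continuous_matrix_map_transpose_mul_add σ J hσ) continuous_const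

omit [DecidableEq m] in
/-- The skew matrices commuting with `x` form a closed set. [cite: PlatonovRapinchuk1994, §3.3] -/
theorem isClosed_setOf_skew_comm [T2Space K] (hσ : Continuous σ) (x : Matrix m m K) :
    IsClosed {X : Matrix m m K | (X.map σ)ᵀ * J + J * X = 0 ∧ X * x = x * X} :=
  (isClosed_setOf_skew σ J hσ).inter (isClosed_eq (continuous_id.matrix_mul continuous_const) (continuous_const.matrix_mul continuous_id))

omit [Fintype m] [DecidableEq m] [IsTopologicalRing K] in
/-- The inclusion of an additive subgroup with closed carrier is a closed embedding (as an additive hom `V →+ M_m(K)`). [cite: PlatonovRapinchuk1994, §3.3] -/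
theorem isClosedEmbedding_subtype_of_eq (𝔲 : AddSubgroup (Matrix m m K)) {S : Set (Matrix m m K)} (hS : IsClosed S) (h𝔲 : (𝔲 : Set (Matrix m m K)) = S) :
    IsClosedEmbedding (𝔲.subtype : ↥𝔲 →+ Matrix m m K) := by
  have : IsClosed (𝔲 : Set (Matrix m m K)) := h𝔲 ▸ hS
  exact this.isClosedEmbedding_subtypeVal

end Ranges

/-! ## §2 ★ (C4u) on the two model pairs -/

section Model

variable {K : Type*} [Field K] [ValuativeRel K] [TopologicalSpace K] [IsNonarchimedeanLocalField K]
  {m : Type*} [Fintype m] [DecidableEq m] (σ : K →+* K) (J : Matrix m m K)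

/-- **THE CAYLEY CHART OF `U(J)(K)` CARRIES HAAR MEASURE** (★ C4u with `ρ = subtype`, `x = 1`, `ι = 𝔲.subtype`). [cite: Helgason2000, Ch. I §1 Thm. 1.14 (13) p. 96] -/
theorem exists_cayley_chart_haar_unitary [T2Space K] (hσ : Continuous σ)
    (𝔲 : AddSubgroup (Matrix m m K)) (h𝔲 : ∀ X, X ∈ 𝔲 ↔ (X.map σ)ᵀ * J + J * X = 0)
    [SecondCountableTopology ↥𝔲] [MeasurableSpace ↥𝔲] [BorelSpace ↥𝔲]
    [LocallyCompactSpace ↥(unitaryGroupOfForm σ J)] [SecondCountableTopology ↥(unitaryGroupOfForm σ J)]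
    [MeasurableSpace ↥(unitaryGroupOfForm σ J)] [BorelSpace ↥(unitaryGroupOfForm σ J)]
    (μ : Measure ↥𝔲) [μ.IsAddHaarMeasure] (ν : Measure ↥(unitaryGroupOfForm σ J)) [ν.IsHaarMeasure]
    {α β : ValueGroupWithZero K} (hα : α ≠ 0) (hα1 : α < 1) (hβ0 : β ≠ 0) (hβ : β < valuation K 2) (hβα : β ≤ valuation K 2 * α) :
    ∃ (Λ : ℕ → AddSubgroup ↥𝔲) (c : ↥𝔲 → ↥(unitaryGroupOfForm σ J)) (σV : ↥𝔲 → ↥𝔲 → ↥𝔲),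
      (∀ j X, X ∈ Λ j ↔ ValBound (α ^ (j + 1)) (X : Matrix m m K)) ∧
      (∀ X ∈ Λ 0, (((c X : ↥(unitaryGroupOfForm σ J)) : GL m K) : Matrix m m K) = cayley (X : Matrix m m K)) ∧
      (∀ W ∈ Λ 0, ∀ X ∈ Λ 0, ((σV W X : ↥𝔲) : Matrix m m K)
        = (1 - (W : Matrix m m K))⁻¹ * ((W : Matrix m m K) + X) * (1 + (W : Matrix m m K) * X)⁻¹ * (1 - (W : Matrix m m K))) ∧
      (∀ W ∈ Λ 0, ContinuousOn (σV W) (Λ 0 : Set ↥𝔲)) ∧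
      (∀ g : ↥(unitaryGroupOfForm σ J), ValBound β (((g : GL m K) : Matrix m m K) - 1) → g ∈ c '' (Λ 0 : Set ↥𝔲)) ∧
      (μ.restrict (Λ 0 : Set ↥𝔲)).map c = (μ (Λ 0 : Set ↥𝔲) / ν (c '' (Λ 0 : Set ↥𝔲))) • ν.restrict (c '' (Λ 0 : Set ↥𝔲)) ∧
      (∀ A ⊆ (Λ 0 : Set ↥𝔲), MeasurableSet (c '' A) → μ A = (μ (Λ 0 : Set ↥𝔲) / ν (c '' (Λ 0 : Set ↥𝔲))) * ν (c '' A)) := by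
  have hιr : ∀ X, X ∈ Set.range (𝔲.subtype : ↥𝔲 →+ Matrix m m K) ↔ ((X.map σ)ᵀ * J + J * X = 0 ∧ X * 1 = 1 * X) := by
    intro X
    rw [Matrix.mul_one, Matrix.one_mul]
    constructor
    · rintro ⟨Y, rfl⟩; exact ⟨(h𝔲 Y).1 Y.2, rfl⟩
    · rintro ⟨hX, -⟩; exact ⟨⟨X, (h𝔲 X).2 hX⟩, rfl⟩
  have hι : IsClosedEmbedding (𝔲.subtype : ↥𝔲 →+ Matrix m m K) :=
    isClosedEmbedding_subtype_of_eq 𝔲 (isClosed_setOf_skew σ J hσ) (Set.ext fun X => by simpa using h𝔲 X)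
  have hρ : IsInducing ((unitaryGroupOfForm σ J).subtype : ↥(unitaryGroupOfForm σ J) →* GL m K) := IsInducing.subtypeVal
  have hρinj : Function.Injective ((unitaryGroupOfForm σ J).subtype : ↥(unitaryGroupOfForm σ J) →* GL m K) :=
    Subtype.val_injective
  exact exists_cayley_chart_haar σ J 1 𝔲.subtype (unitaryGroupOfForm σ J).subtype μ ν hι hρ hρinj hιr
    (range_subtype_unitary_iff σ J) hα hα1 hβ0 hβ hβα

/-- **THE CAYLEY CHART OF THE CARTAN `T = Z_{U(J)}(γ₀)` CARRIES HAAR MEASURE** (★ C4u with `ρ = subtype ∘ subtype`, `x = γ₀`, `ι = 𝔱.subtype`).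
[cite: Helgason2000, Ch. I §1 Thm. 1.14 (13) p. 96] -/
theorem exists_cayley_chart_haar_cartan [T2Space K] (hσ : Continuous σ) (γ₀ : ↥(unitaryGroupOfForm σ J))
    (T : Subgroup ↥(unitaryGroupOfForm σ J)) (hT : ∀ g : ↥(unitaryGroupOfForm σ J), g ∈ T ↔ g * γ₀ = γ₀ * g)
    (𝔱 : AddSubgroup (Matrix m m K))
    (h𝔱 : ∀ X, X ∈ 𝔱 ↔ ((X.map σ)ᵀ * J + J * X = 0 ∧ X * ((γ₀ : GL m K) : Matrix m m K) = ((γ₀ : GL m K) : Matrix m m K) * X))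
    [SecondCountableTopology ↥𝔱] [MeasurableSpace ↥𝔱] [BorelSpace ↥𝔱]
    [LocallyCompactSpace ↥T] [SecondCountableTopology ↥T] [MeasurableSpace ↥T] [BorelSpace ↥T]
    (μT : Measure ↥𝔱) [μT.IsAddHaarMeasure] (tm : Measure ↥T) [tm.IsHaarMeasure]
    {α β : ValueGroupWithZero K} (hα : α ≠ 0) (hα1 : α < 1) (hβ0 : β ≠ 0) (hβ : β < valuation K 2) (hβα : β ≤ valuation K 2 * α) :
    ∃ (Λ : ℕ → AddSubgroup ↥𝔱) (c : ↥𝔱 → ↥T) (σV : ↥𝔱 → ↥𝔱 → ↥𝔱),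
      (∀ j X, X ∈ Λ j ↔ ValBound (α ^ (j + 1)) (X : Matrix m m K)) ∧
      (∀ X ∈ Λ 0, ((((c X : ↥T) : ↥(unitaryGroupOfForm σ J)) : GL m K) : Matrix m m K) = cayley (X : Matrix m m K)) ∧
      (∀ W ∈ Λ 0, ∀ X ∈ Λ 0, ((σV W X : ↥𝔱) : Matrix m m K)
        = (1 - (W : Matrix m m K))⁻¹ * ((W : Matrix m m K) + X) * (1 + (W : Matrix m m K) * X)⁻¹ * (1 - (W : Matrix m m K))) ∧
      (∀ W ∈ Λ 0, ContinuousOn (σV W) (Λ 0 : Set ↥𝔱)) ∧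
      (∀ t : ↥T, ValBound β ((((t : ↥(unitaryGroupOfForm σ J)) : GL m K) : Matrix m m K) - 1) → t ∈ c '' (Λ 0 : Set ↥𝔱)) ∧
      (μT.restrict (Λ 0 : Set ↥𝔱)).map c = (μT (Λ 0 : Set ↥𝔱) / tm (c '' (Λ 0 : Set ↥𝔱))) • tm.restrict (c '' (Λ 0 : Set ↥𝔱)) ∧
      (∀ A ⊆ (Λ 0 : Set ↥𝔱), MeasurableSet (c '' A) → μT A = (μT (Λ 0 : Set ↥𝔱) / tm (c '' (Λ 0 : Set ↥𝔱))) * tm (c '' A)) := by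
  have hιr : ∀ X, X ∈ Set.range (𝔱.subtype : ↥𝔱 →+ Matrix m m K) ↔
      ((X.map σ)ᵀ * J + J * X = 0 ∧ X * ((γ₀ : GL m K) : Matrix m m K) = ((γ₀ : GL m K) : Matrix m m K) * X) := by
    intro X
    constructor
    · rintro ⟨Y, rfl⟩; exact (h𝔱 Y).1 Y.2
    · intro hX; exact ⟨⟨X, (h𝔱 X).2 hX⟩, rfl⟩
  have hι : IsClosedEmbedding (𝔱.subtype : ↥𝔱 →+ Matrix m m K) :=
    isClosedEmbedding_subtype_of_eq 𝔱 (isClosed_setOf_skew_comm σ J hσ _) (Set.ext fun X => by simpa using h𝔱 X)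
  have hρ : IsInducing (((unitaryGroupOfForm σ J).subtype).comp T.subtype : ↥T →* GL m K) :=
    IsInducing.subtypeVal.comp IsInducing.subtypeVal
  have hρinj : Function.Injective (((unitaryGroupOfForm σ J).subtype).comp T.subtype : ↥T →* GL m K) :=
    Subtype.val_injective.comp Subtype.val_injective
  exact exists_cayley_chart_haar σ J _ 𝔱.subtype (((unitaryGroupOfForm σ J).subtype).comp T.subtype) μT tm hι hρ hρinj hιr
    (range_subtype_centralizer_iff σ J hT) hα hα1 hβ0 hβ hβα

end Model

end Summit.HodgeConjecture.HodgeConjecture.Cruxes.H413.F0P3cStCharTSCayleyChartUnitaryModel
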